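import Summits.QuantumFields.BalabanUV.T4Continuum.Support.NE7OneStepOfLocalChartRatio
import Summits.QuantumFields.BalabanUV.T4Continuum.Support.NE7InteriorInduction
import HarnessLib

/-!
# NE7 — (8)∃ «a constrained minimiser strictly inside the class at every level» FROM THE LOCAL CHART (F285)

[Balaban1985Variational] Thm 1 (8) p. 279 ∘ Prop 8 ∘ [Balaban1983Laplace] Thm 2, row NE7.  Composition of
F284c `NE7OneStepOfLocalChartRatio.oneStep_of_chart_regime_ratio` at the ratio `λ = 1/L²` (the small-field
ONE-STEP at `δ = ε/L²` from THE LOCAL CHART, row NE3's `hleaves`, `LevelSmall`, slice Poincaré and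
route Π's lines, budget discharged) with the interior induction of [Balaban1985Variational] Sect. A,
`NE7InteriorInduction.hint_of_oneStep` (`δ·L² ≤ ε`): for `ℓ ≥ ℓ₀`, `0 < ε ≤ ε₀`, `0 < β ≤ β₀(ε)` and every
period `N ≥ 1` there is `δ_V > 0` such that over the small data
`dom = {V | unitary, N-periodic, SmallField V δ_V}` the hypothesis **(8)∃** — the `hint` binder of
`NE7InteriorMinimiserDocking.hminE_of_interior_exists` and of route 1's END
`NE7Route1EndDockedInterior.goodClause_summable_of_route1_docked_interior` — HOLDS: at every level some
constrained Wilson minimiser over `sfClass (d+1) L N ε` is `SmallField U a` with `0 ≤ a < ε(L^k)^(−2)`.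
Bill (asserted for nothing): THE CHART ([B8] Thm 2 at `U₀ = 1` on nested cubes of radius
`(nbRad + 2ℓ + 10)·M`, constants `≤ A(ℓ+1)^p`, small field `r ≤ ε/L²`), row NE3's `hleaves` (at
`δ₁ = ε/(2L²)`), `LevelSmall`, the slice Poincaré inequality, route Π's two `k`-free lines.  Nothing of
Bałaban's is asserted as an axiom; NE7 is NOT proved unconditionally.
-/

open scoped BigOperators Matrix Matrix.Norms.L2Operator Topology
open NormedSpace Finset Set Filter

namespace Summit.QuantumFields.BalabanUV.T4Continuum.NE7HintOfLocalChart

open Literature.MathematicalPhysics.QuantumFieldTheory.Balaban1983to89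
open B7Prop1Explicit B7Prop2Explicit MatrixLog UnitaryModel
open B4TorusKernel.MultiPeriod (torusSupNorm)
open T4AveragingDeficitWall (IsUnitaryCfg IsSkewDir SmallField vary curl curlSq dirSq dirL1)
open T4AveragingDeficitWallBoundary (IsPeriodicCfg periodBox)
open AveragingDeficitPeriodicCounting (IsPeriodicDir)
open AveragingDeficitMultiLevelPrep (LevelSmall tower TangentIter)
open BlockAverageVaryHolo (nbRad)
open MinimalActionLevels (perWin)
open MinimalActionSandwich (IsMinimiser admissible)
open MinimalActionRate (sfClass)
open NE3HessForm (dAction)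
open NE3SlicePoincareShape (SlicePoincare)
open NE3FrameFreeSliceW (frameFreeBlockLandauW)
open NE3TangentCovariantTower (dirIter)
open NE3DecomposedRepOfLinearNormalPart (ResidualSliceRepT)
open NE3QbarIterCovLiftPrep (cruxC)
open NE3SmoothRightInverseW (rightInvW)
open NE3RightInverseSolveLetters (thetaLoc)
open NE3RightInverseL2Letter (l2C)
open NE3HatInvCurlLetters (curl2C curl1C)
open NE3EnergyShapes (IsUnitarySite)
open BlockAveragePushDirSplit (flat)
open NE7OneStepOfLocalChartRatio (oneStep_of_chart_regime_ratio)
open NE7InteriorInduction (hint_of_oneStep)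

variable {d : ℕ} {n : Type*} [Fintype n] [DecidableEq n]

set_option maxHeartbeats 400000 in
/-- **F285 — (8)∃ from the local chart.**  [Balaban1985Variational] Thm 1 (8) ∘ Prop 8 ∘ [Balaban1983Laplace]
Thm 2, rows NE7 ∘ NE3: for every polynomial growth law `A·(ℓ+1)^p` of the chart constants there are
`ℓ ≥ 1`, `ε₀ > 0` and, for every `0 < ε ≤ ε₀`, a `β₀ > 0` such that for `0 < β ≤ β₀` and every period
`N ≥ 1`: IF `LevelSmall`, the slice Poincaré inequality, route Π's two `k`-free lines, THE LOCAL CHART on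
the `(4ℓ+12)`-fold cover (constants `≤ A(ℓ+1)^p`, small field `r ≤ ε/L²`) and row NE3's `hleaves` (at
`δ₁ = ε/(2L²)`) hold, THEN for some `δ_V > 0`, over `dom = {V | unitary, N-periodic, SmallField V δ_V}`,
at every level `k` some constrained minimiser over `sfClass (d+1) L N ε` is `SmallField U a` with
`0 ≤ a < ε/(L^k)²` — the hypothesis (8)∃ (`hint`) of the energy road's docking, by name-shape. -/
theorem hint_of_localChart [Nonempty n] {L : ℕ} [NeZero L] (hL : 2 ≤ L) {A : ℝ} (hA : 0 ≤ A) (p : ℕ) :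
    ∃ ℓ : ℕ, 1 ≤ ℓ ∧ ∃ ε₀ : ℝ, 0 < ε₀ ∧ ∀ ε : ℝ, 0 < ε → ε ≤ ε₀ → ∃ β₀ : ℝ, 0 < β₀ ∧ ∀ β : ℝ, 0 < β → β ≤ β₀ →
    ∀ (N : ℕ) [NeZero N] (CP C₀ C₁ C₂ αh Ch νh κh : ℝ), 1 ≤ N → 0 < CP →
    (∀ k : ℕ, LevelSmall (d + 1) L k (ε / ((L : ℝ) ^ (k + 1)) ^ 2)) →
    (∀ (j : ℕ) (W' : Site (d + 1) → Fin (d + 1) → (Matrix n n ℂ)ˣ), W' ∈ sfClass (d + 1) L N ε (j + 1) → SlicePoincare L (j + 1) W' (frameFreeBlockLandauW L N (j + 1) W') CP (periodBox (d := d + 1) (N * L ^ (j + 1)))) →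
    0 ≤ C₂ → 0 ≤ αh → αh ≤ 1 → 0 ≤ Ch →
    νh = 2 * Real.sqrt (l2C (d + 1) L / (1 - thetaLoc (d + 1) L * ε) ^ 2 + curl2C (d + 1) L / (1 - thetaLoc (d + 1) L * ε) ^ 2) * C₂ * Ch * αh →
    κh = 4 * (curl1C (d + 1) L / (1 - thetaLoc (d + 1) L * ε)) * C₂ * Ch ^ 2 * ε →
    νh < 1 →
    2 * (κh / (1 - νh) ^ 2) < ((((1 / 2 - (νh / (1 - νh)) ^ 2) / (2 * (1 + CP)) - (νh / (1 - νh)) ^ 2) / 2 - 576 * ((d + 1 : ℕ) : ℝ) * (αh ^ 2 * Real.exp (2 * αh))) / (Fintype.card n : ℝ) - 28 * ((d + 1 : ℕ) : ℝ) * (ε + 7 * αh ^ 2)) →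
    -- the chart constants, polynomial in `ℓ + 1`
    0 ≤ C₀ → C₀ ≤ A * ((ℓ : ℝ) + 1) ^ p → 0 ≤ C₁ → C₁ ≤ A * ((ℓ : ℝ) + 1) ^ p →
    -- THE CHART (N1)-weak at `δ = λε`: [B8] Thm 2 at `U₀ = 1` on nested cubes, TYPE (asserted for nothing here)
    (∀ D : Site (d + 1) → Fin (d + 1) → (Matrix n n ℂ)ˣ, IsUnitaryCfg D → IsPeriodicCfg D ((N * (4 * ℓ + 12)) : ℤ) → SmallField D (4 * (Real.exp β - 1)) →
      ∀ (k : ℕ), ∀ U ∈ admissible (sfClass (d + 1) L (N * (4 * ℓ + 12)) ε) L (k + 1) D,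
      (∀ φ : Site (d + 1) → Fin (d + 1) → Matrix n n ℂ, IsSkewDir φ → IsPeriodicDir φ (((N * (4 * ℓ + 12)) * L ^ (k + 1) : ℕ) : ℤ) → TangentIter L k U φ →
        dAction U φ (perWin (d + 1) ((N * (4 * ℓ + 12)) * L ^ (k + 1))) = 0) →
      ∀ r : ℝ, 0 ≤ r → r ≤ (1 / (L : ℝ) ^ 2 * ε) → SmallField U (r / ((L : ℝ) ^ (k + 1)) ^ 2) →
      ∀ z : Site (d + 1), ∃ (u : Site (d + 1) → (Matrix n n ℂ)ˣ) (At : Site (d + 1) → Fin (d + 1) → Matrix n n ℂ) (a₀ a₁ : ℝ),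
        IsUnitarySite u ∧ (∀ (y : Site (d + 1)) (i : Fin (d + 1)), u (y + (((N * (4 * ℓ + 12)) * L ^ (k + 1) : ℕ) : ℤ) • e i) = u y) ∧
        IsSkewDir At ∧ IsPeriodicDir At (((N * (4 * ℓ + 12)) * L ^ (k + 1) : ℕ) : ℤ) ∧ 0 ≤ a₀ ∧ 0 ≤ a₁ ∧
        (∀ (y : Site (d + 1)) (κ : Fin (d + 1)), ‖At y κ‖ ≤ a₀) ∧ (∀ (y : Site (d + 1)) (κ τ : Fin (d + 1)), ‖At (y + e τ) κ - At y κ‖ ≤ a₁) ∧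
        (L : ℝ) ^ (k + 1) * a₀ ≤ C₀ * (r + 4 * (Real.exp β - 1) + ε) ∧ ((L : ℝ) ^ (k + 1)) ^ 2 * a₁ ≤ C₁ * (r + 4 * (Real.exp β - 1) + ε) ∧
        (∀ (y : Site (d + 1)) (κ : Fin (d + 1)),
          torusSupNorm (fun _ : Fin (d + 1) => L ^ (k + 1) * (N * (4 * ℓ + 12))) (y - z) ≤ (((nbRad (d + 1) L + 2 * ℓ + 10) * L ^ (k + 1) : ℕ) : ℝ) →
            gaugeAct u U y κ = vary (flat (d := d + 1) (n := n)) At 1 y κ)) →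
    -- ROW NE3's PER-PAIR BINDER on the data class at `δ₁ = λε/2` (F31's `hleaves`, dimension `d + 1`)
    (∀ D : Site (d + 1) → Fin (d + 1) → (Matrix n n ℂ)ˣ, IsUnitaryCfg D → IsPeriodicCfg D (N : ℤ) → SmallField D (4 * (Real.exp β - 1)) → ∀ (k : ℕ), ∀ Us ∈ admissible (sfClass (d + 1) L N ε) L (k + 1) D, SmallField Us ((1 / (L : ℝ) ^ 2 * ε / 2) / ((L : ℝ) ^ (k + 1)) ^ 2) → (∀ φ : Site (d + 1) → Fin (d + 1) → Matrix n n ℂ, IsSkewDir φ → IsPeriodicDir φ ((N * L ^ (k + 1) : ℕ) : ℤ) → TangentIter L k Us φ → dAction Us φ (perWin (d + 1) (N * L ^ (k + 1))) = 0) → ∀ U' ∈ admissible (sfClass (d + 1) L N ε) L (k + 1) D, ∃ (u : Site (d + 1) → (Matrix n n ℂ)ˣ) (X₀ : Site (d + 1) → Fin (d + 1) → Matrix n n ℂ) (α₀ : ℝ) (m : Site (d + 1) → Fin (d + 1) → ℝ) (C : ℝ), IsSkewDir X₀ ∧ (∀ (hWu : IsUnitaryCfg Us) (hx : 0 ≤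 ε / ((L : ℝ) ^ (k + 1)) ^ 2) (hs : LevelSmall (d + 1) L k (ε / ((L : ℝ) ^ (k + 1)) ^ 2)) (hWx : SmallField Us (ε / ((L : ℝ) ^ (k + 1)) ^ 2)) (hθ : cruxC (d + 1) L * (((L : ℝ) ^ (k + 1)) ^ 2 * (ε / ((L : ℝ) ^ (k + 1)) ^ 2)) < 1) (hφ : IsSkewDir (dirIter L (k + 1) Us X₀)), ResidualSliceRepT L N (k + 1) Us U' u X₀ (rightInvW hL k hWu hx hs hWx N hθ hφ) α₀) ∧ (∀ z κ, 0 ≤ m z κ) ∧ 0 ≤ C ∧ ((L : ℝ) ^ (k + 1)) ^ (d + 1) * ∑ z ∈ periodBox (d := d + 1) N, ∑ κ : Fin (d + 1), m z κ ^ 2 ≤ C ^ 2 * dirSq X₀ (periodBox (d := d + 1) (N * L ^ (k + 1))) ∧ (∀ z ∈ periodBox (d := d + 1) N, ∀ κ : Fin (d + 1), ‖dirIter L (k + 1) Us X₀ z κ‖ ≤ C₂ * ((L : ℝ) ^ (k + 1) * m z κ) ^ 2) ∧ α₀ * (L : ℝ) ^ (k + 1) ≤ αh ∧ (∀ z κ,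 m z κ * (L : ℝ) ^ (k + 1) ≤ αh) ∧ C ≤ Ch) →
    ∃ δV : ℝ, 0 < δV ∧
      ∀ V ∈ {V : Site (d + 1) → Fin (d + 1) → (Matrix n n ℂ)ˣ | IsUnitaryCfg V ∧ IsPeriodicCfg V (N : ℤ) ∧ SmallField V δV},
      ∀ k : ℕ, ∃ U : Site (d + 1) → Fin (d + 1) → (Matrix n n ℂ)ˣ, IsMinimiser (d + 1) (sfClass (d + 1) L N ε) L N k V U ∧
        ∃ a : ℝ, 0 ≤ a ∧ a < ε / ((L : ℝ) ^ k) ^ 2 ∧ SmallField U a := by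
  have hL1 : (1 : ℝ) ≤ (L : ℝ) := by exact_mod_cast (le_trans one_le_two hL)
  have hL2 : (2 : ℝ) ≤ (L : ℝ) := by exact_mod_cast hL
  have hLsq : (4 : ℝ) ≤ (L : ℝ) ^ 2 := by nlinarith [hL2]
  have hl0 : (0 : ℝ) < 1 / (L : ℝ) ^ 2 := by positivity
  have hl1 : 1 / (L : ℝ) ^ 2 < 1 := by rw [div_lt_one (by positivity)]; linarith
  obtain ⟨ℓ, hℓ1, ε₀, hε₀, H⟩ := oneStep_of_chart_regime_ratio (d := d) (n := n) hL hA p hl0 hl1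
  refine ⟨ℓ, hℓ1, ε₀, hε₀, fun ε hε hεle => ?_⟩
  obtain ⟨β₀, hβ₀, H2⟩ := H ε hε hεle
  refine ⟨β₀, hβ₀, ?_⟩
  intro β hβ hβle N _ CP C₀ C₁ C₂ αh Ch νh κh hN hCP hls hP hC₂ hαh0 hαh1 hCh0 hνh hκh hν hline hC₀ hC₀b hC₁ hC₁b hchart hleaves
  obtain ⟨γ, hγ, hstep⟩ := H2 β hβ hβle N CP C₀ C₁ C₂ αh Ch νh κh hN hCP hls hP hC₂ hαh0 hαh1 hCh0 hνh hκh hν hline hC₀ hC₀b hC₁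
    hC₁b hchart hleaves
  have hδ0 : (0 : ℝ) < 1 / (L : ℝ) ^ 2 * ε := mul_pos hl0 hε
  refine ⟨min γ (1 / (L : ℝ) ^ 2 * ε), lt_min hγ hδ0, ?_⟩
  have hδL : 1 / (L : ℝ) ^ 2 * ε * (L : ℝ) ^ 2 ≤ ε := by
    rw [div_mul_eq_mul_div, one_mul, div_mul_cancel₀ _ (by positivity)]
  exact hint_of_oneStep (d := d + 1) (le_trans one_le_two hL) (le_min hγ.le hδ0.le) (min_le_right _ _)
    (mul_lt_of_lt_one_left hε hl1) hδL
    (fun V hVu hVp hVδ => hstep V hVu hVp (MinimalActionRate.SmallField.mono hVδ (min_le_left _ _)))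

end Summit.QuantumFields.BalabanUV.T4Continuum.NE7HintOfLocalChart
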